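import Summits.BirchSwinnertonDyer.BirchSwinnertonDyer.Theorems.QuadraticBranchSignedControlPlusEtaNonsurjPrimeLFunctionRows
import Summits.BirchSwinnertonDyer.BirchSwinnertonDyer.Theorems.QuadraticBranchSignedControlPlusEtaNonsurjCMRankZeroSha
import HarnessLib

/-!
# Route `QuadraticBranchSignedControl` (rung K8, cell `bsd-potss`), residual crux
# `PlusEtaMainConjectureNonsurj` (stmt-BirchSwinnertonDyer-19606): RECORD SHAPE for the rank-`1` rows with a
# CM UNIT ANCHOR — Kobayashi's even main conjecture at `η` at `(V,p)` for every good `a_p = 0` model `V` of the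
# `p*`-twist of a curve `W` of analytic rank `1`, congruent mod `p` to the twist `V′` of a CM curve `W′` of
# analytic rank `0` with `p ∤ #Ш(W′)_an`, MODULO the Hatley–Lei transfer, the congruence and the shape
# `(L_p⁺(V,η,X)) = (X)` (seat `bsd-potss-k8eta-c2` g4; file 3, sequel of `…PrimeLFunctionRows.lean`)

WHAT. Files 1–2 (`EtaPrimeRoad`, p508939 / p509721): on a row with `Sel_{p^∞}(W/ℚ)` infinite and
`(L_p⁺(V,η,X)) = (X)`, (C1⁺_η)(V,p) ⟸ `μ(X⁺(V/K_∞)^η) = 0`; and `μ = 0` at `V` ⟸ `μ = 0` at a congruent anchor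
`V′` by Hatley–Lei 2019 Thm. 4.6 at `η` (displayed `hHL`, seat g3), which HOLDS when `V′` is the twist of a UNIT
row `W′` (`Sel_{p^∞}(W′/ℚ) = 0`, `p ∤ Tam(W′)`: seat g2's theorem). This file packages the per-row inputs of
the census's anchors — CM curves `W′` of analytic rank `0` with `p ∤ #Ш(W′)_an` — into that shape:
* `selmerGroupPInfty_eq_bot_of_hasCM_of_analyticRank_eq_zero` — `W′` CM, `r_an(W′) = 0`, `#Ш(W′)_an = s`,
  `p ∤ s` ⟹ `Sel_{p^∞}(W′/ℚ) = 0` (GZK: rank `0`, `Ш` finite; Burungale–Flach bsd.S28: `BSD(W′,p)`, so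
  `ord_p #Ш(W′)[p^∞] = v_p(s) = 0`); `p ∤ Tam(W′)` is AUTOMATIC for CM (`X12.not_dvd_tamagawaProduct_of_hasCM`).
* **`etaMC_r1_of_cmUnitAnchor`** — the record shape: named facts `h22`, `h41`, `hmod`, `hGZK`, `hS28`; the
  displayed transfer `hHL`; anchor `W′` (CM, `r_an = 0`, `#Ш_an = s′`, `p ∤ s′`); row `W` (`r_an = 1`); for
  EVERY globally minimal `V′ = C′ • W′^{(p*)}` and `V = C • W^{(p*)}` good at `p` with `a_p = 0`,
  `V′[p] ≅ V[p]` (displayed) and `(L_p⁺(V,η,X)) = (X)` (displayed): `QuadraticBranchPlusEtaMainConjectureAt V p`.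
Consumed by `…PlusEtaNonsurjPrimeLFunctionRecords.lean` (the 9 unit-anchored non-CM rank-`1` rows of the
census: 104400dc1, 26100h1, 243900o1, 243900p1, 313200el1, 341775ca1, 341775dj1, 417600ke1, 458100j1 at
`p = 5`, anchors 3600bb1 / 900b1 / 10800cj1 / 11025e1 / 14400cz1).

HONEST FRAMING (cell `bsd-potss`, run/shared/lean/pub/bsd-potss/; FULL-BSD rank ≤ 1 programme,
tranche 1b, HUMAN RULING D-0036/D-0074): BOOKKEEPING THEOREMS ONLY — no definition, no named Literature
fact minted, no Summits-side `def … : Prop`, no `sorry`, axioms standard. CONDITIONAL on Kobayashi Thm.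
2.2 / 4.1 (rational clause) at `η`, modularity, GZK, Burungale–Flach 2024 (named facts, hypothesis
position) and on the DISPLAYED Hatley–Lei transfer, congruence and `L`-function shape. No stub of 19606 is
proved by name; the crux stays OPEN; nothing is booked; no label / mark / count moves; `BSD(W′,p)` is bsd.S28,
`BSD(W,p)` is claimed for no pair. `--supports stmt-BirchSwinnertonDyer-19606`.

References: [HatleyLei2019] Thm. 4.6; [Kobayashi2003] Thm. 2.2 (p. 5), §4 + Thm. 4.1 (p. 8);
[BurungaleFlach2024] Thm. 1.1 + Cor. 2; [GreenbergLNM1716] §1 p. 54, §3 Prop. 3.8, §4 Lemma 4.2;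
[KrausOesterle1992] Prop. 4; [SilvermanAEC2009] VII.6, App. C §11; [Cremona1997] Table 1.
-/

set_option autoImplicit false
set_option linter.dupNamespace false

noncomputable section

open scoped Classical

open CongruenceSubgroup Field Function NumberField IsDedekindDomain WeierstrassCurve
open Literature.NumberTheory.EllipticCurves
open Literature.NumberTheory.EllipticCurves.ModularForms
open Literature.NumberTheory.EllipticCurves.Rank1Residual
open Literature.NumberTheory.EllipticCurves.Rank1Residual.Typed
open Literature.NumberTheory.EllipticCurves.Rank1Residual.X11RankOneCertificates
open Literature.NumberTheory.GaloisRepresentations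
open Literature.NumberTheory.GaloisCohomology
open Literature.NumberTheory.EllipticCurves.IwasawaAlgebra
open Literature.NumberTheory.EllipticCurves.IwasawaDual ZpExtension
open Literature.NumberTheory.EllipticCurves.GreenbergVatsal2000
open Summit.BirchSwinnertonDyer.Rank1Residual.X11b.Levels
open Summit.BirchSwinnertonDyer.Rank1Residual.X11b
open Summit.BirchSwinnertonDyer.Rank1Residual.Additive
open Summit.BirchSwinnertonDyer.Rank1Residual.Additive.SignedTwist
open scoped ContRepresentation
open Summit.BirchSwinnertonDyer.Rank1Residual.AdditivePotMult
open Summit.BirchSwinnertonDyer.Rank1Residual.O6 (ModPCongruent)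

namespace Summit.BirchSwinnertonDyer.BirchSwinnertonDyer.Theorems

namespace EtaPrimeRoad

/-! ## §1 The anchor's input: `Sel_{p^∞}(W′/ℚ) = 0` for a CM curve of analytic rank `0` with `p ∤ #Ш(W′)_an` -/

section Anchor

variable (W' : WeierstrassCurve ℚ) [W'.IsElliptic] [W'.IsGloballyMinimal] (p : ℕ) [hp : Fact p.Prime]

/-- **`W′` CM, `r_an(W′) = 0`, `#Ш(W′)_an = s` with `p ∤ s` ⟹ `Sel_{p^∞}(W′/ℚ) = 0`** (named facts: modularity,
GZK, Burungale–Flach bsd.S28). GZK gives rank `0` and `Ш(W′)` finite; bsd.S28 gives `BSD(W′,p)`, i.e.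
`ord_p #Ш(W′)[p^∞] = v_p(#Ш_an) = 0`; so `#Sel_{p^∞}(W′/ℚ) = #Ш(W′)[p^∞] = 1` (seat g2's
`EtaUnitRows.selmerGroupPInfty_eq_bot_of_finite_of_padicValNat_card_sha`). CONDITIONAL; nothing booked.
[cite: BurungaleFlach2024, Thm 1.1 and Cor. 2] [cite: GreenbergLNM1716, §1 p. 54] -/
theorem selmerGroupPInfty_eq_bot_of_hasCM_of_analyticRank_eq_zero (hmod : hasEntireLFunction_rat)
    (hGZK : rank_eq_analyticRank_of_analyticRank_le_one) (hS28 : bsdTriple_of_hasCM_of_L_one_ne_zero)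
    (hCM : W'.HasCM) (hr : W'.analyticRank = 0) {s : ℕ} (hs : shaAn W' = (s : ℂ)) (hps : ¬ p ∣ s) :
    W'.selmerGroupPInfty p = ⊥ := by
  have hLW : W'.entireLFunction 1 ≠ 0 := (W'.analyticRank_eq_zero_iff_holds (hmod _)).mp hr
  obtain ⟨hrank, hfin⟩ := hGZK W' (by rw [hr]; exact zero_le_one)
  haveI : Finite W'.sha := hfin
  haveI : Finite W'.toAffine.Point := W'.finite_point_of_rank_zero (by rw [hrank, hr])
  obtain ⟨-, -, q, hq, hvq⟩ := forall_bsdp_of_bsdTriple' W' (hS28 W' hCM hLW) p hp.out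
  have hqs : q = (s : ℚ) := by
    have h : ((q : ℚ) : ℂ) = ((s : ℚ) : ℂ) := by rw [← hq, hs]; push_cast; rfl
    exact_mod_cast h
  have hsha0 : padicValNat p (Nat.card W'.sha) = 0 := by
    rw [← padicValNat_card_addPrimaryComponent (A := W'.sha) p]
    have h : (padicValNat p (Nat.card (AddCommGroup.primaryComponent W'.sha p)) : ℤ) ≤ 0 := by
      rw [← hvq, hqs, padicValRat.of_nat, padicValNat.eq_zero_of_not_dvd hps]
      simp
    omega
  exact EtaUnitRows.selmerGroupPInfty_eq_bot_of_finite_of_padicValNat_card_sha W' p hsha0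

end Anchor

/-! ## §2 The record shape: a rank-`1` row with a CM unit anchor -/

section Shape

variable (p : ℕ) [hp : Fact p.Prime]

/-- **RECORD SHAPE — (C1⁺_η)(V,p) on a rank-`1` row from a CM UNIT ANCHOR.** Named facts `h22`, `h41`
(Kobayashi Thm. 2.2 / Thm. 4.1 rational clause at `η`), `hmod`, `hGZK`, `hS28` (Burungale–Flach); the
TRANSFER `hHL` (Hatley–Lei Thm. 4.6 at `η`, displayed verbatim as in seat g3's `EtaCongruentAnchor`); the
ANCHOR `W′`: globally minimal, CM (`hCM'`), `r_an(W′) = 0` (`hr'`), `#Ш(W′)_an = s′` with `p ∤ s′` (`hs'`,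
`hps'`; Cremona, displayed) — so `Sel_{p^∞}(W′/ℚ) = 0` (§1) and `p ∤ Tam(W′)` (CM, automatic); the ROW `W`:
`r_an(W) = 1` (`hr`, displayed; so `Sel_{p^∞}(W/ℚ)` is infinite by GZK). Then for EVERY globally minimal
`V′` with `C′ • W′^{(p*)} = V′` and `V` with `C • W^{(p*)} = V`, both good at `p` with `a_p = 0`, IF
`V′[p] ≅ V[p]` (`hcong`, displayed — Kraus–Oesterlé certificate per row) and `(L_p⁺(V,η,X)) = (X)` (`hX`,
displayed — PARI `(λ,μ) = (1,0)` + `L(W,1) = 0`), THEN `QuadraticBranchPlusEtaMainConjectureAt V p`. File 2's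
`…_of_modPCongruent_unitRow_of_span_eq_span_X` with the anchor's inputs discharged. CONDITIONAL; per row;
nothing booked. [cite: HatleyLei2019, Thm. 4.6] [cite: Kobayashi2003, §4 Even main conjecture and Thm. 4.1 (p. 8)]
[cite: BurungaleFlach2024, Thm 1.1 and Cor. 2] [cite: KrausOesterle1992, Prop. 4] [cite: Cremona1997, Table 1] -/
theorem etaMC_r1_of_cmUnitAnchor
    (h22 : Kobayashi2003.thm22_etaSignedSelmerDual_finite_torsion)
    (h41 : Kobayashi2003.thm41_plusEtaCharIdeal_dvd)
    (hmod : hasEntireLFunction_rat) (hGZK : rank_eq_analyticRank_of_analyticRank_le_one)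
    (hS28 : bsdTriple_of_hasCM_of_L_one_ne_zero) (hp5 : 5 ≤ p)
    (hHL : ∀ (V' : WeierstrassCurve ℚ) [V'.IsElliptic] [V'.IsGloballyMinimal]
        (V : WeierstrassCurve ℚ) [V.IsElliptic] [V.IsGloballyMinimal],
        5 ≤ p → V'.HasGoodReductionAtPrime p → V'.frobeniusTrace p = 0 →
        V.HasGoodReductionAtPrime p → V.frobeniusTrace p = 0 → ModPCongruent V' V p →
      (∀ (K₀ : Type) [Field K₀] [NumberField K₀] [IsCyclotomicExtension {p} ℚ K₀]
          [(galRange (K := ℚ) K₀).Normal] (ηq : absoluteGaloisGroup ℚ →* ℤˣ),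
          (∀ σ ∈ galRange (K := ℚ) K₀, ηq σ = 1) → ηq ≠ 1 →
        ∀ (κ : ZpExtension ℚ p) (γ : absoluteGaloisGroup ℚ),
          κ.IsCyclotomic → κ.IsTopGenerator γ → γ ∈ galRange (K := ℚ) K₀ →
        ∀ (D : EtaSignedSelmerDualData V' κ K₀ ℚ_[p] ηq γ 1) (g : IwasawaAlgebra p),
          D.charIdeal = Ideal.span {g} → HasUnitContent g) →
      (∀ (K₀ : Type) [Field K₀] [NumberField K₀] [IsCyclotomicExtension {p} ℚ K₀]
          [(galRange (K := ℚ) K₀).Normal] (ηq : absoluteGaloisGroup ℚ →* ℤˣ),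
          (∀ σ ∈ galRange (K := ℚ) K₀, ηq σ = 1) → ηq ≠ 1 →
        ∀ (κ : ZpExtension ℚ p) (γ : absoluteGaloisGroup ℚ),
          κ.IsCyclotomic → κ.IsTopGenerator γ → γ ∈ galRange (K := ℚ) K₀ →
        ∀ (D : EtaSignedSelmerDualData V κ K₀ ℚ_[p] ηq γ 1) (g : IwasawaAlgebra p),
          D.charIdeal = Ideal.span {g} → HasUnitContent g))
    (W' : WeierstrassCurve ℚ) [W'.IsElliptic] [W'.IsGloballyMinimal] (hCM' : W'.HasCM)
    (hr' : W'.analyticRank = 0) {s' : ℕ} (hs' : shaAn W' = (s' : ℂ)) (hps' : ¬ p ∣ s')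
    (W : WeierstrassCurve ℚ) [W.IsElliptic] (hr : W.analyticRank = 1)
    (V' : WeierstrassCurve ℚ) [V'.IsElliptic] [V'.IsGloballyMinimal] (C' : VariableChange ℚ)
    (hCV' : C' • W'.quadraticTwist ((-1) ^ (p / 2) * p) = V')
    (hgood' : V'.HasGoodReductionAtPrime p) (hap' : V'.frobeniusTrace p = 0)
    (V : WeierstrassCurve ℚ) [V.IsElliptic] [V.IsGloballyMinimal] (C : VariableChange ℚ)
    (hCV : C • W.quadraticTwist ((-1) ^ (p / 2) * p) = V)
    (hgood : V.HasGoodReductionAtPrime p) (hap : V.frobeniusTrace p = 0) (hcong : ModPCongruent V' V p)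
    (hX : ∀ {N : ℕ} [NeZero N] {f : CuspForm (Gamma0 N) 2}, IsNewformOf V f →
      ∀ (ϖ : ℚ), (if Even (p / 2) then (ϖ : ℝ) * V.realPeriodRat = plusPeriod f
          else (ϖ : ℝ) * V.imaginaryPeriodRat = minusPeriod f) →
      ∀ (Lη : IwasawaAlgebra p), IsQuadraticBranchPlusLFunction f p ϖ Lη →
        Ideal.span {Lη} = Ideal.span {(PowerSeries.X : IwasawaAlgebra p)}) :
    QuadraticBranchPlusEtaMainConjectureAt V p :=
  quadraticBranchPlusEtaMainConjectureAt_of_modPCongruent_unitRow_of_span_eq_span_X p h22 h41 hGZK hHL V' W'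
    C' V W C hp5 hCV' hgood' hap'
    (selmerGroupPInfty_eq_bot_of_hasCM_of_analyticRank_eq_zero W' p hmod hGZK hS28 hCM' hr' hs' hps')
    (Summit.BirchSwinnertonDyer.Rank1Residual.X12.not_dvd_tamagawaProduct_of_hasCM W' hCM' p hp5)
    hCV hgood hap hcong hr hX

/-- **RECORD SHAPE, literal-anchor form** (consumed by the record files): as `etaMC_r1_of_cmUnitAnchor` with
the anchor a LITERAL integer equation `W′ = ⟨b₁,…,b₆⟩` (elliptic and globally minimal: instance binders,
decided per curve by x11b's Kraus criterion — REUSED from seat g2's `EtaCMUnitRecords`) whose CM is DECIDED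
in the kernel from `j = c₄³/Δ ∈` the thirteen CM values (`hj'`, `EtaUnitRows.ratCurve_j` + the tree theorem
`hasCM_iff_j_mem_holds`). CONDITIONAL; per row; nothing booked. [cite: HatleyLei2019, Thm. 4.6]
[cite: Kobayashi2003, §4 Even main conjecture and Thm. 4.1 (p. 8)] [cite: SilvermanAEC2009, App. C §11]
[cite: Cremona1997, Table 1] -/
theorem etaMC_r1_of_cmUnitAnchor_of_ainvs
    (h22 : Kobayashi2003.thm22_etaSignedSelmerDual_finite_torsion)
    (h41 : Kobayashi2003.thm41_plusEtaCharIdeal_dvd)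
    (hmod : hasEntireLFunction_rat) (hGZK : rank_eq_analyticRank_of_analyticRank_le_one)
    (hS28 : bsdTriple_of_hasCM_of_L_one_ne_zero) (hp5 : 5 ≤ p)
    (hHL : ∀ (V' : WeierstrassCurve ℚ) [V'.IsElliptic] [V'.IsGloballyMinimal]
        (V : WeierstrassCurve ℚ) [V.IsElliptic] [V.IsGloballyMinimal],
        5 ≤ p → V'.HasGoodReductionAtPrime p → V'.frobeniusTrace p = 0 →
        V.HasGoodReductionAtPrime p → V.frobeniusTrace p = 0 → ModPCongruent V' V p →
      (∀ (K₀ : Type) [Field K₀] [NumberField K₀] [IsCyclotomicExtension {p} ℚ K₀]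
          [(galRange (K := ℚ) K₀).Normal] (ηq : absoluteGaloisGroup ℚ →* ℤˣ),
          (∀ σ ∈ galRange (K := ℚ) K₀, ηq σ = 1) → ηq ≠ 1 →
        ∀ (κ : ZpExtension ℚ p) (γ : absoluteGaloisGroup ℚ),
          κ.IsCyclotomic → κ.IsTopGenerator γ → γ ∈ galRange (K := ℚ) K₀ →
        ∀ (D : EtaSignedSelmerDualData V' κ K₀ ℚ_[p] ηq γ 1) (g : IwasawaAlgebra p),
          D.charIdeal = Ideal.span {g} → HasUnitContent g) →
      (∀ (K₀ : Type) [Field K₀] [NumberField K₀] [IsCyclotomicExtension {p} ℚ K₀]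
          [(galRange (K := ℚ) K₀).Normal] (ηq : absoluteGaloisGroup ℚ →* ℤˣ),
          (∀ σ ∈ galRange (K := ℚ) K₀, ηq σ = 1) → ηq ≠ 1 →
        ∀ (κ : ZpExtension ℚ p) (γ : absoluteGaloisGroup ℚ),
          κ.IsCyclotomic → κ.IsTopGenerator γ → γ ∈ galRange (K := ℚ) K₀ →
        ∀ (D : EtaSignedSelmerDualData V κ K₀ ℚ_[p] ηq γ 1) (g : IwasawaAlgebra p),
          D.charIdeal = Ideal.span {g} → HasUnitContent g))
    (b1 b2 b3 b4 b6 : ℤ) [(⟨b1, b2, b3, b4, b6⟩ : WeierstrassCurve ℚ).IsElliptic]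
    [(⟨b1, b2, b3, b4, b6⟩ : WeierstrassCurve ℚ).IsGloballyMinimal]
    (hj' : ((c4Of [b1, b2, b3, b4, b6] ^ 3 : ℤ) : ℚ) / ((discOf [b1, b2, b3, b4, b6] : ℤ) : ℚ) ∈ cmJInvariants)
    (hr' : (⟨b1, b2, b3, b4, b6⟩ : WeierstrassCurve ℚ).analyticRank = 0) {s' : ℕ}
    (hs' : shaAn (⟨b1, b2, b3, b4, b6⟩ : WeierstrassCurve ℚ) = (s' : ℂ)) (hps' : ¬ p ∣ s')
    (W : WeierstrassCurve ℚ) [W.IsElliptic] (hr : W.analyticRank = 1)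
    (V' : WeierstrassCurve ℚ) [V'.IsElliptic] [V'.IsGloballyMinimal] (C' : VariableChange ℚ)
    (hCV' : C' • (⟨b1, b2, b3, b4, b6⟩ : WeierstrassCurve ℚ).quadraticTwist ((-1) ^ (p / 2) * p) = V')
    (hgood' : V'.HasGoodReductionAtPrime p) (hap' : V'.frobeniusTrace p = 0)
    (V : WeierstrassCurve ℚ) [V.IsElliptic] [V.IsGloballyMinimal] (C : VariableChange ℚ)
    (hCV : C • W.quadraticTwist ((-1) ^ (p / 2) * p) = V)
    (hgood : V.HasGoodReductionAtPrime p) (hap : V.frobeniusTrace p = 0) (hcong : ModPCongruent V' V p)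
    (hX : ∀ {N : ℕ} [NeZero N] {f : CuspForm (Gamma0 N) 2}, IsNewformOf V f →
      ∀ (ϖ : ℚ), (if Even (p / 2) then (ϖ : ℝ) * V.realPeriodRat = plusPeriod f
          else (ϖ : ℝ) * V.imaginaryPeriodRat = minusPeriod f) →
      ∀ (Lη : IwasawaAlgebra p), IsQuadraticBranchPlusLFunction f p ϖ Lη →
        Ideal.span {Lη} = Ideal.span {(PowerSeries.X : IwasawaAlgebra p)}) :
    QuadraticBranchPlusEtaMainConjectureAt V p :=
  etaMC_r1_of_cmUnitAnchor p h22 h41 hmod hGZK hS28 hp5 hHL _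
    ((hasCM_iff_j_mem_holds _).mpr (by rw [EtaUnitRows.ratCurve_j]; exact hj')) hr' hs' hps' W hr V' C'
    hCV' hgood' hap' V C hCV hgood hap hcong hX

end Shape

end EtaPrimeRoad

end Summit.BirchSwinnertonDyer.BirchSwinnertonDyer.Theorems

end
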